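import Literature.AlgebraicGeometry.Resolution.DecompletionEtaleCoordinates
import Literature.AlgebraicGeometry.Resolution.OriginLocalRing
import Mathlib.RingTheory.Unramified.LocalStructure
import Mathlib.RingTheory.Unramified.LocalRing
import Mathlib.RingTheory.Localization.LocalizationLocalization
import Mathlib.RingTheory.Jacobson.Ring
import Mathlib.FieldTheory.Perfect
import HarnessLib

/-!
# Formally smooth coordinates at a closed point of a smooth algebra over a perfect field

Topic: `Literature/AlgebraicGeometry/Resolution`. Let `K` be a PERFECT field, `S` a finitely presented, formally
smooth (i.e. smooth) `K`-algebra, `𝔮 ⊂ S` a MAXIMAL ideal and `B = S_𝔮` (any `IsLocalization.AtPrime`). PROVED: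

* `exists_formallySmooth_coordinates` — there are finitely many `x₁, …, xₙ ∈ B` GENERATING `𝔪_B` such that `B` is
  formally smooth over `K[X₁,…,Xₙ]` for `Xᵢ ↦ xᵢ` («a regular system of parameters at a closed point of a smooth
  variety over a perfect field is a system of étale coordinates»).

Proof: Mathlib's local structure theorem (`Algebra.IsSmoothAt.exists_isStandardEtale_mvPolynomial`) makes `S[1/f]`,
`f ∉ 𝔮`, standard étale over `K[X′₁,…,X′ₙ]`; the values `tᵢ ∈ κ(𝔮)` of the coordinates `T′ᵢ` are separable over `K`
(`κ(𝔮)/K` is finite by Zariski's lemma, `K` is perfect), so the tree's `etale_minpolyCoordMap`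
(`DecompletionEtaleCoordinates.lean`, Temkin's re-centring `Tᵢ = pᵢ(T′ᵢ)`, `pᵢ = minpoly_K tᵢ`) gives ÉTALE coordinates
`K[X] → S[1/f][1/D]` VANISHING at `𝔮` with `D` invertible at `𝔮`; `B` is a localization of `S[1/f][1/D]`, hence
formally smooth (indeed formally étale) over `K[X]`; and along the formally unramified, essentially finite-type local
homomorphism `K[X]_{(X)} → B` the maximal ideal extends to the maximal ideal (Mathlib
`Algebra.FormallyUnramified.map_maximalIdeal`), i.e. the `xᵢ` generate `𝔪_B`.

Consumer: `Hironaka2017/Proofs/S05NegativePart/U27L24.lean` (the order criterion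
`TaylorLiftOrderCriterion.diffIdeal_span_singleton_pow_eq_top_of_formallySmooth` at closed points of an ambient scheme);
nothing about that manuscript is asserted here.

Sources: [StacksProject] Tag 00TA/054L (smooth ⇒ étale over affine space locally), Tag 00UW (unramified local
algebras); [Matsumura1987] Thm. 25.2, §28; M. Temkin, J. Algebra 373 (2013), proof of Lemma 3.3.2 (re-centring). [Temkin2013]
-/

noncomputable section

open MvPolynomial IsLocalRing

namespace Literature.AlgebraicGeometry.Resolution

universe u

/-- **Formally smooth coordinates generating the maximal ideal, at a closed point of a smooth algebra over a perfect
field.** Let `K` be perfect, `S` finitely presented and formally smooth over `K`, `𝔮 ⊂ S` maximal, `B = S_𝔮`. Then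
`𝔪_B = (x₁,…,xₙ)` for some `xᵢ` with `B` formally smooth over `K[X₁,…,Xₙ]`, `Xᵢ ↦ xᵢ`.
[cite: StacksProject, Tag 054L (smooth is étale-locally affine space) with Tag 00UW (unramified local algebras)] -/
theorem exists_formallySmooth_coordinates {K : Type u} [Field K] [PerfectField K]
    {S : Type u} [CommRing S] [Algebra K S] [Algebra.FinitePresentation K S] [Algebra.FormallySmooth K S]
    (𝔮 : Ideal S) [𝔮.IsMaximal]
    {B : Type u} [CommRing B] [IsLocalRing B] [Algebra S B] [IsLocalization.AtPrime B 𝔮]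
    [Algebra K B] [IsScalarTower K S B] :
    ∃ (n : ℕ) (x : Fin n → B), Ideal.span (Set.range x) = maximalIdeal B ∧
      (letI := (MvPolynomial.aeval x : MvPolynomial (Fin n) K →ₐ[K] B).toRingHom.toAlgebra
       Algebra.FormallySmooth (MvPolynomial (Fin n) K) B) := by
  classical
  -- smooth at `𝔮`
  haveI : Algebra.IsSmoothAt K 𝔮 := by
    haveI : Algebra.FormallySmooth S (Localization.AtPrime 𝔮) :=
      Algebra.FormallySmooth.of_isLocalization (M := 𝔮.primeCompl)
    exact Algebra.FormallySmooth.comp K S (Localization.AtPrime 𝔮)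
  -- Mathlib's local structure: `S[1/f]` standard étale over `K[X′]`
  obtain ⟨f, hf, n, algS₀, htow, hstd⟩ :=
    Algebra.IsSmoothAt.exists_isStandardEtale_mvPolynomial (R := K) (p := 𝔮)
  set R := MvPolynomial (Fin n) K with hR
  set S₀ := Localization.Away f with hS₀
  letI := algS₀
  haveI := htow
  haveI := hstd
  -- `S₀ → B`
  have hfu : IsUnit (algebraMap S B f) := IsLocalization.map_units B (⟨f, hf⟩ : 𝔮.primeCompl)
  let φB : S₀ →+* B := IsLocalization.Away.lift f hfu
  have hφB : ∀ s, φB (algebraMap S S₀ s) = algebraMap S B s := IsLocalization.Away.lift_eq f hfu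
  letI algS₀B : Algebra S₀ B := φB.toAlgebra
  have hφB' : ∀ s : S₀, algebraMap S₀ B s = φB s := fun _ => rfl
  haveI towS : IsScalarTower S S₀ B :=
    IsScalarTower.of_algebraMap_eq (R := S) (S := S₀) (A := B) fun s => (hφB s).symm
  haveI towK : IsScalarTower K S₀ B :=
    IsScalarTower.of_algebraMap_eq (R := K) (S := S₀) (A := B) fun c => by
      rw [IsScalarTower.algebraMap_apply K S S₀ c, IsScalarTower.algebraMap_apply K S B c]
      exact (hφB _).symm
  -- the residue field is finite, hence separable, over `K`
  have hsurjS : Function.Surjective ((residue B).comp (algebraMap S B)) := by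
    intro c
    obtain ⟨b, rfl⟩ := Ideal.Quotient.mk_surjective c
    obtain ⟨⟨s, u⟩, rfl⟩ := IsLocalization.mk'_surjective 𝔮.primeCompl b
    -- `u` is invertible modulo the maximal ideal `𝔮`
    letI := Ideal.Quotient.field 𝔮
    have hu : Ideal.Quotient.mk 𝔮 (u : S) ≠ 0 := by
      rw [Ne, Ideal.Quotient.eq_zero_iff_mem]
      exact u.2
    obtain ⟨v, hv⟩ := Ideal.Quotient.mk_surjective ((Ideal.Quotient.mk 𝔮 (u : S))⁻¹)
    have huv : (u : S) * v - 1 ∈ 𝔮 := by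
      rw [← Ideal.Quotient.eq, map_mul, hv, mul_inv_cancel₀ hu, map_one]
    refine ⟨s * v, ?_⟩
    change residue B (algebraMap S B (s * v)) = residue B (IsLocalization.mk' B s u)
    rw [← sub_eq_zero, ← map_sub, residue_eq_zero_iff]
    have e1 : algebraMap S B (s * v) - IsLocalization.mk' B s u =
        IsLocalization.mk' B s u * algebraMap S B ((u : S) * v - 1) := by
      rw [map_sub, map_one, map_mul (algebraMap S B) (u : S) v, mul_sub, mul_one, ← mul_assoc,
        IsLocalization.mk'_spec, map_mul]
    rw [e1]
    exact Ideal.mul_mem_left _ _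
      ((IsLocalization.AtPrime.to_map_mem_maximal_iff (S := B) (I := 𝔮) _).mpr huv)
  haveI : Algebra.FiniteType K (ResidueField B) := by
    haveI : Algebra.FiniteType K S := inferInstance
    refine Algebra.FiniteType.of_surjective
      (((Ideal.Quotient.mkₐ K (maximalIdeal B)).comp (IsScalarTower.toAlgHom K S B)) : S →ₐ[K] ResidueField B) ?_
    exact hsurjS
  haveI : Module.Finite K (ResidueField B) := finite_of_finite_type_of_isJacobsonRing K (ResidueField B)
  haveI : Algebra.IsAlgebraic K (ResidueField B) := Algebra.IsAlgebraic.of_finite K (ResidueField B)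
  haveI : Algebra.IsSeparable K (ResidueField B) := inferInstance
  -- the values of the old coordinates at the point, and the evaluation `φ₀ : S₀ → κ`
  let t : Fin n → ResidueField B := fun i => residue B (algebraMap S₀ B (algebraMap R S₀ (X i)))
  have hsep : ∀ i, IsSeparable K (t i) := fun i => Algebra.IsSeparable.isSeparable K (t i)
  let φ₀ : S₀ →+* ResidueField B := (residue B).comp (algebraMap S₀ B)
  have hφ₀' : φ₀.comp (algebraMap R S₀) = (MvPolynomial.aeval t : R →ₐ[K] ResidueField B).toRingHom := by
    refine MvPolynomial.ringHom_ext (fun c => ?_) (fun i => ?_)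
    · rw [RingHom.comp_apply, AlgHom.toRingHom_eq_coe, AlgHom.coe_toRingHom, MvPolynomial.algHom_C,
        ← MvPolynomial.algebraMap_eq, ← IsScalarTower.algebraMap_apply K R S₀]
      change residue B (algebraMap S₀ B (algebraMap K S₀ c)) = _
      rw [← IsScalarTower.algebraMap_apply K S₀ B]
      rfl
    · rw [RingHom.comp_apply, AlgHom.toRingHom_eq_coe, AlgHom.coe_toRingHom, MvPolynomial.aeval_X]
      rfl
  have hφ₀ : ∀ q : R, φ₀ (algebraMap R S₀ q) = MvPolynomial.aeval t q := fun q => by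
    have := RingHom.congr_fun hφ₀' q
    rwa [RingHom.comp_apply, AlgHom.toRingHom_eq_coe, AlgHom.coe_toRingHom] at this
  -- re-centred étale coordinates `ψ : K[X] → S₁ = S₀[1/D]`
  have hetale := etale_minpolyCoordMap (S₀ := S₀) K t
  set D := minpolyCoordDen (S₀ := S₀) K t with hD
  set S₁ := Localization.Away D with hS₁
  set ψ := minpolyCoordMap (S₀ := S₀) K t with hψ
  -- `S₁ → B`
  have hDu : IsUnit (algebraMap S₀ B D) := by
    have hne := eval_minpolyCoordDen_ne_zero (S₀ := S₀) K t φ₀ hφ₀ hsep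
    exact (residue_ne_zero_iff_isUnit _).mp hne
  let φ1 : S₁ →+* B := IsLocalization.Away.lift D hDu
  have hφ1 : ∀ s, φ1 (algebraMap S₀ S₁ s) = algebraMap S₀ B s := IsLocalization.Away.lift_eq D hDu
  letI algS₁B : Algebra S₁ B := φ1.toAlgebra
  have hφ1' : ∀ s : S₁, algebraMap S₁ B s = φ1 s := fun _ => rfl
  haveI : IsScalarTower S₀ S₁ B :=
    IsScalarTower.of_algebraMap_eq (R := S₀) (S := S₁) (A := B) fun s => (hφ1 s).symm
  haveI : IsScalarTower S S₁ B :=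
    IsScalarTower.of_algebraMap_eq (R := S) (S := S₁) (A := B) fun s => by
      rw [hφ1', IsScalarTower.algebraMap_apply S S₀ S₁ s, hφ1, hφB', hφB]
  -- `B` is a localization of `S₁`
  set M₀ := IsLocalization.localizationLocalizationSubmodule (Submonoid.powers f) (Submonoid.powers D)
    with hM₀
  haveI : IsLocalization M₀ S₁ :=
    IsLocalization.localization_localization_isLocalization (M := Submonoid.powers f) (N := Submonoid.powers D)
      (T := S₁)
  have hM₀le : M₀ ≤ 𝔮.primeCompl := by
    intro s hs
    rw [hM₀, IsLocalization.mem_localizationLocalizationSubmodule] at hs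
    obtain ⟨⟨y, hy⟩, ⟨z, hz⟩, e⟩ := hs
    obtain ⟨a, rfl⟩ := hy
    obtain ⟨b, rfl⟩ := hz
    intro hs𝔮
    have h1 : residue B (algebraMap S B s) = 0 := by
      rw [residue_eq_zero_iff]
      exact (IsLocalization.AtPrime.to_map_mem_maximal_iff (S := B) (I := 𝔮) s).mpr hs𝔮
    have h2 : residue B (algebraMap S B s) ≠ 0 := by
      have e2 : algebraMap S B s = algebraMap S₀ B D ^ a * algebraMap S B f ^ b := by
        rw [← hφB s, e, map_pow (algebraMap S S₀), map_mul, map_pow, map_pow, hφB, hφB']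
      rw [e2, map_mul, map_pow, map_pow]
      refine mul_ne_zero (pow_ne_zero _ ?_) (pow_ne_zero _ ?_)
      · exact eval_minpolyCoordDen_ne_zero (S₀ := S₀) K t φ₀ hφ₀ hsep
      · exact (residue_ne_zero_iff_isUnit _).mpr hfu
    exact h2 h1
  haveI hlocB : IsLocalization (𝔮.primeCompl.map (algebraMap S S₁)) B :=
    IsLocalization.isLocalization_of_submonoid_le (M := M₀) (N := 𝔮.primeCompl) S₁ B hM₀le
  -- `K[X] → S₁ → B` is formally étale and essentially of finite type (ring-hom level: the re-centred structure
  -- `ψ` on `S₁` is not the coefficient-wise one inherited from `S₀`)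
  have hψfe : ψ.FormallyEtale := @Algebra.Etale.formallyEtale R S₁ _ _ ψ.toAlgebra hetale
  have hψfp : ψ.FinitePresentation := @Algebra.Etale.finitePresentation R S₁ _ _ ψ.toAlgebra hetale
  have hψeft : ψ.EssFiniteType := (RingHom.FiniteType.of_finitePresentation hψfp).essFiniteType
  haveI : Algebra.FormallyEtale S₁ B :=
    Algebra.FormallyEtale.of_isLocalization (M := 𝔮.primeCompl.map (algebraMap S S₁))
  haveI : Algebra.EssFiniteType S₁ B :=
    Algebra.EssFiniteType.of_isLocalization _ (𝔮.primeCompl.map (algebraMap S S₁))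
  have hφ1fe : φ1.FormallyEtale := ‹Algebra.FormallyEtale S₁ B›
  have hφ1eft : φ1.EssFiniteType := RingHom.essFiniteType_algebraMap.mpr ‹Algebra.EssFiniteType S₁ B›
  have hΦfe : (φ1.comp ψ).FormallyEtale := RingHom.FormallyEtale.comp hψfe hφ1fe
  have hΦeft : (φ1.comp ψ).EssFiniteType := RingHom.EssFiniteType.comp hψeft hφ1eft
  letI algRB : Algebra R B := (φ1.comp ψ).toAlgebra
  have halgRB : ∀ q, algebraMap R B q = φ1 (ψ q) := fun _ => rfl
  haveI : Algebra.FormallyEtale R B := hΦfe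
  haveI hFS : Algebra.FormallySmooth R B := inferInstance
  haveI hFU : Algebra.FormallyUnramified R B := inferInstance
  haveI hEFT : Algebra.EssFiniteType R B := RingHom.essFiniteType_algebraMap.mp hΦeft
  -- the coordinates
  let x : Fin n → B := fun i => φ1 (ψ (X i))
  have hKS₁B : ∀ c : K, φ1 (algebraMap K S₁ c) = algebraMap K B c := fun c => by
    rw [IsScalarTower.algebraMap_apply K S₀ S₁, hφ1, ← IsScalarTower.algebraMap_apply]
  have halg : (MvPolynomial.aeval x : R →ₐ[K] B).toRingHom = φ1.comp ψ := by
    refine MvPolynomial.ringHom_ext (fun c => ?_) (fun i => ?_)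
    · rw [AlgHom.toRingHom_eq_coe, AlgHom.coe_toRingHom, MvPolynomial.algHom_C, RingHom.comp_apply, hψ,
        minpolyCoordMap_C, hKS₁B]
    · rw [AlgHom.toRingHom_eq_coe, AlgHom.coe_toRingHom, MvPolynomial.aeval_X, RingHom.comp_apply]
  -- the `xᵢ` lie in `𝔪_B`
  have hxmem : ∀ i, x i ∈ maximalIdeal B := by
    intro i
    rw [← residue_eq_zero_iff]
    change residue B (φ1 (ψ (X i))) = 0
    rw [hψ, minpolyCoordMap_X, hφ1]
    exact eval_minpolyCoord (S₀ := S₀) K t φ₀ hφ₀ i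
  -- the prime `𝔫 = (X)` under `𝔪_B`
  set 𝔫 : Ideal R := (maximalIdeal B).comap (algebraMap R B) with h𝔫
  haveI h𝔫p : 𝔫.IsPrime := Ideal.IsPrime.comap _
  have h𝔫X : ∀ i, (X i : R) ∈ 𝔫 := fun i => by
    rw [h𝔫, Ideal.mem_comap, halgRB]
    exact hxmem i
  have h𝔫eq : 𝔫 = originIdeal K n := by
    refine ((originIdeal.isMaximal (F := K) (n := n)).eq_of_le h𝔫p.ne_top ?_).symm
    rw [originIdeal_eq_span, Ideal.span_le]
    rintro _ ⟨i, rfl⟩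
    exact h𝔫X i
  -- the local homomorphism `K[X]_𝔫 → B`
  have hunits : ∀ y : 𝔫.primeCompl, IsUnit (algebraMap R B y) := by
    intro y
    by_contra hy
    exact y.2 ((IsLocalRing.mem_maximalIdeal _).mpr hy)
  let φA : Localization.AtPrime 𝔫 →+* B := IsLocalization.lift (M := 𝔫.primeCompl) hunits
  have hφA : ∀ r : R, φA (algebraMap R (Localization.AtPrime 𝔫) r) = algebraMap R B r :=
    fun r => IsLocalization.lift_eq hunits r
  letI algA'B : Algebra (Localization.AtPrime 𝔫) B := φA.toAlgebra
  haveI : IsScalarTower R (Localization.AtPrime 𝔫) B :=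
    IsScalarTower.of_algebraMap_eq (R := R) (S := Localization.AtPrime 𝔫) (A := B) fun r => (hφA r).symm
  haveI : Algebra.FormallyUnramified (Localization.AtPrime 𝔫) B :=
    Algebra.FormallyUnramified.of_restrictScalars R (Localization.AtPrime 𝔫) B
  haveI : Algebra.EssFiniteType (Localization.AtPrime 𝔫) B :=
    Algebra.EssFiniteType.of_comp R (Localization.AtPrime 𝔫) B
  haveI : IsLocalHom (algebraMap (Localization.AtPrime 𝔫) B) := by
    refine ⟨fun a ha => ?_⟩
    obtain ⟨⟨r, s⟩, rfl⟩ := IsLocalization.mk'_surjective 𝔫.primeCompl a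
    rw [IsLocalization.AtPrime.isUnit_mk'_iff]
    intro hr
    have hsu : IsUnit (algebraMap (Localization.AtPrime 𝔫) B
        (algebraMap R (Localization.AtPrime 𝔫) (s : R))) := by
      rw [← IsScalarTower.algebraMap_apply]
      exact hunits s
    have hrs : algebraMap (Localization.AtPrime 𝔫) B (IsLocalization.mk' (Localization.AtPrime 𝔫) r s) *
        algebraMap (Localization.AtPrime 𝔫) B (algebraMap R (Localization.AtPrime 𝔫) (s : R)) =
          algebraMap R B r := by
      rw [← map_mul, IsLocalization.mk'_spec, ← IsScalarTower.algebraMap_apply]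
    have hu : IsUnit (algebraMap R B r) := by
      rw [← hrs]
      exact ha.mul hsu
    exact ((IsLocalRing.mem_maximalIdeal _).mp (Ideal.mem_comap.mp hr)) hu
  have hmap := Algebra.FormallyUnramified.map_maximalIdeal (R := Localization.AtPrime 𝔫) (S := B)
  rw [← Localization.AtPrime.map_eq_maximalIdeal, Ideal.map_map, ← IsScalarTower.algebraMap_eq] at hmap
  -- conclusion
  refine ⟨n, x, ?_, ?_⟩
  · rw [← hmap, h𝔫eq, originIdeal_eq_span, Ideal.map_span, ← Set.range_comp]
    rfl
  · rw [halg]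
    exact hFS

end Literature.AlgebraicGeometry.Resolution

end
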